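import Summits.QuantumFields.BalabanUV.Beta.GAN24.HalfMemberSlavedDivergence

/-!
# `BalabanUV.Beta.GAN24.HalfMemberSlavedDivergenceComb` — binder row G-an2-4 ∕ (CONV-C), W-slot EXIT (α) (the OWNER gan24-p1 g33's located ask W9 l.49725
# **(α-END-b1) «THE EVEN MEMBER's SLAVED DIVERGENCE»**), PART 2 of `HalfMemberSlavedDivergence`: **SLAVE-src FOR THE `ε`-MEMBER OF an2's DRESSED COMB TOWER —
# THE COMPOSITION OF PART 1's T-EQ (§1) WITH PART 1's PARITY-SPLIT SLAVING (§2) UNDER THE TWO RAW TABLE LAWS (LETTERS), AND THE TWO NAMED MEMBERS: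
# EVEN (`ε = 1`, NO remainder `R`) and ODD (`ε = −1`, NO commutator)**
# (G-an2-4 FORMAL swarm → CRUX TEAM (2), leaf-01 lineage `b2b-balaban-gan24-formalise-leaf-01`, gen 72)

NOT IN PRINT; OUR BOOKKEEPING ([folklore] composition BY NAME; 0 `def`, 0 cited facts, 0 `def … : Prop`, 0 sorry).  HONEST FRAMING (cell contract, verbatim):
«discharging `BetaPertH` makes Bałaban's UV stability UNCONDITIONAL — a real constructive-QFT result; it is NOT the continuum limit and NOT the Clay problem.»
HONEST DEPENDENCY (verbatim): «continuum YM on T⁴ ⇐ BetaPertH ∧ nine spine estimates (0/9 proved); BetaPertH ⇐ (D1) ∧ (D4) ∧ CAP+tail; G-an2-4 gates asym, D1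
and NE2/3/4.»

WHAT (objects as in PART 1 and leaf-06's `T2SlavedDivergence`: `T̃_j`, `T♮̃_j := unitS₂_j T̃_j`, `K♮ᴱ_j`, `c₄ := cE₂·Lc^{2(d+1)}`, the dressed source `b♮̃_j`, `P := sgnK ∘ trK`
slotwise, `y_j := ½ • (T♮̃_j + ε • P T♮̃_j)`; in-block root, `1 ≤ Lc`, border data `hBff hBmm hB`; generic `d`):
* §3 **`divW_halfMember_succ_eq_slaved`** (letters `S X R R″ cH′`, `cH′ ≠ 0`; the two RAW table laws `hTL ∕ hTL″` of `T̃_j` in the literal conclusion shape of D1's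
  `WardLocusQuarticTable.tableLaw_T2RecAt_succ ∕ '' ∕ _zero ∕ ''` — verbatim leaf-06's §3 letters —, the commutator word parity-EVEN `hC`, the remainders parity-ODD
  `hR hR″`): `divW (y_{j+1}) y ν y′ = divW (½ • (b♮̃_j + ε • P b♮̃_j)) y ν y′ + (c₄·(Lc^{d+1})⁻¹∕2) • (e3OfK Lc K♮ᴱ_j [(sf_j·sm_j)⁻¹ • unitS_j (cH′⁻¹ • (((1+ε)∕2) •
  (S ∘ X_y − X_y ∘ S) + ((1−ε)∕2) • R y))] ν y′ + the ″ twin)`;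
  **`divW_evenMember_succ_eq_slaved`** (`ε = 1`, junction spelling `½ • (T♮̃ + P T♮̃)`): NO `R` — EXACTLY (α-END-b1)'s displayed sentence «the commutator is EVEN, `R` is
  ODD»; **`divW_oddMember_succ_eq_slaved`** (`ε = −1`, `½ • (T♮̃ − P T♮̃)`): NO commutator — the odd member's slaved divergence is PURE RESIDUAL.
* §3b the SECOND slot: `divV_snd_halfMember_succ_eq` (T-EQ, hypothesis-free) ∕ `divV_snd_halfMember_succ_eq_slaved` — the SAME two `e3OfK` summands read at the
  slot `(κ, u)` (road W3's map is slot-symmetric: leaf-03 g58's `lin4_swap_slots`), so BOTH slot letters of `y_{j+1}` are slaved by (b1).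
Downstream (NOT here): the window step (leaf-02's `SlotDivergenceLetters` ∕ `SlotDefectWindowShapes`) and (Q-L) on the two summands ⟹ the END's displayed `hcell`;
at D1's literal laws the parities `hC hR hR″` are the literal letters' (leaf-05: `S` odd-rowed ⨾ PART 1 `parityEven_comm_of_oddRows`; p2 `WardResidualParity` §3 for the
`𝒩`-word; the border remainder by its own letter).  Asserts NOTHING about Bałaban's tables; 0 estimate; discharges NOTHING of `hcell` ∕ (Q-L) ∕ (C) ∕ «T2Shape» ∕
«T2Drift» ∕ (hW, hWall); (β) of record untouched; NEVER «G-an2-4 closed» as (CONV-C); NOT D1, NOT `BetaPertH`, NOT continuum, NOT Clay.  2026-08-23.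
-/

noncomputable section

open Finset
open scoped BigOperators
open Literature.MathematicalPhysics.QuantumFieldTheory
open Literature.MathematicalPhysics.QuantumFieldTheory.Balaban1983to89
open Literature.MathematicalPhysics.QuantumFieldTheory.Balaban1983to89.Beta
open ExpKernelCalculus (MKer Decays comp)
open OneStepResolventKernel (Fib)
open OneStepKernelFamily (KInvStep)
open SecondOrderResponse (W2SymOfK)
open BalabanStepJetsSucc (mmRead)
open BalabanStepW2 (K3OfK M2Of)
open KernelWard (divV divW)
open AffineAveraging (box toSite)
open BalabanCompositeJets (LocStencil₂)
open AveragingMixedJetTables (mixFFAt)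
open Summit.QuantumFields.BalabanUV.Beta.TameKernelCalculus (trK)
open Summit.QuantumFields.BalabanUV.Beta.BorderedHessian (sgnK)
open Summit.QuantumFields.BalabanUV.Beta.HessKerDressedUnits (unitK unitS)
open Summit.QuantumFields.BalabanUV.Beta.SecondOrderUnits (unitM unitS₂ unitM₂)
open Summit.QuantumFields.BalabanUV.Beta.AxialDressingRooted (coDressKBmAt)
open Summit.QuantumFields.BalabanUV.Beta.SpineRooted (T2RecAt SpureRecAt M1At e3OfK)
open Summit.QuantumFields.BalabanUV.Beta.GAN24.CombesThomas (sfStep smStep)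
open Summit.QuantumFields.BalabanUV.Beta.GAN24.BiStencilZeroMode (Tab)
open Summit.QuantumFields.BalabanUV.Beta.GAN24.T2RecursionAffine (lin4)
open Summit.QuantumFields.BalabanUV.Beta.GAN24.Lin4SlotDivergence (divW_lin4_comb lin4_swap_slots)
open Summit.QuantumFields.BalabanUV.Beta.GAN24.T2SlavedDivergence (divW_add_apply)
open Summit.QuantumFields.BalabanUV.Beta.GAN24.HalfMemberSlavedDivergence (halfMember_succ_eq bdd₄_halfMember divW_halfMember_succ_eq
  boxSum_divV_half_fst_of_tableLaw boxSum_divV_half_snd_of_tableLaw)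

namespace Summit.QuantumFields.BalabanUV.Beta.GAN24.HalfMemberSlavedDivergenceComb

variable {d : ℕ} {Lc : ℕ} [NeZero Lc] {r : Fin (d + 1) → ℕ}

/-! ## §3 SLAVE-src for the `ε`-member: the composition with the two table laws of the raw member (letters + parities) -/

section Comb

/-- NOT IN PRINT; OUR BOOKKEEPING.  **SLAVE-src FOR THE `ε`-MEMBER — ITS SOURCE-SLOT DIVERGENCE ONE LEVEL UP IS SLAVED TO LEVEL-`j` FIRST-ORDER DATA, SPLIT BY PARITY**
(every `ε j y ν y′`; in-block root, `1 ≤ Lc`; border data `hBff hBmm hB`).  HYPOTHESES (letters `S X R R″`, Ward constant `cH′ ≠ 0`): the two TABLE LAWS of the RAW member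
`T̃_j` in the literal conclusion shape of D1's `WardLocusQuarticTable.tableLaw_T2RecAt_succ ∕ ''` resp. `_zero ∕ ''` (`hTL`, `hTL″` — verbatim leaf-06's §3 letters), the
commutator word parity-EVEN (`hC`), the two remainders parity-ODD (`hR`, `hR″`).  CONCLUSION: `divW (y_{j+1}) y ν y′ = divW (½ • (b♮̃_j + ε • P b♮̃_j)) y ν y′ +
(c₄·Lc^{−(d+1)}∕2) • (e3OfK Lc K♮ᴱ_j [(sf_j·sm_j)⁻¹ • unitS_j (cH′⁻¹ • (((1+ε)∕2) • (S ∘ X_y − X_y ∘ S) + ((1−ε)∕2) • R y))] ν y′ + the ″ twin)` (§1 + §2). -/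
theorem divW_halfMember_succ_eq_slaved (hLc : 1 ≤ Lc) (hr : r ∈ box (d + 1) Lc) (cE cVH cΛ cE₂ cB : ℝ) (Tc : Fin 4 → Fin 4 → Fin 4 → Fin 4 → ℝ)
    {vh₂S : Tab d} (hBff : ∀ κ u κ' u' x z (α β : Fin (d + 1)), vh₂S κ u κ' u' x z (Sum.inl α) (Sum.inl β) = 0)
    (hBmm : ∀ κ u κ' u' x z (μ ν : Fin (d + 1)), vh₂S κ u κ' u' x z (Sum.inr μ) (Sum.inr ν) = 0)
    (hB : ∃ C δ : ℝ, 0 < δ ∧ LocStencil₂ vh₂S C δ) (j : ℕ)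
    {S : Fin (d + 1) → (Fin (d + 1) → ℤ) → MKer (d + 1) (Fib d)} {X : (Fin (d + 1) → ℤ) → MKer (d + 1) (Fib d)}
    {R R'' : (Fin (d + 1) → ℤ) → Fin (d + 1) → (Fin (d + 1) → ℤ) → MKer (d + 1) (Fib d)} {cH' : ℝ} (hcH : cH' ≠ 0)
    (hTL : ∀ (Y : Fin (d + 1) → ℤ) (κ' : Fin (d + 1)) (u' : Fin (d + 1) → ℤ),
      cH' • ∑ v ∈ box (d + 1) Lc, divV (fun κ u => T2RecAt d Lc (toSite r) cE cVH cΛ cE₂ cB Tc vh₂S (mixFFAt (toSite r) Lc) j κ u κ' u') ((Lc : ℤ) • Y + toSite v)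
        = comp (S κ' u') (X Y) - comp (X Y) (S κ' u') + R Y κ' u')
    (hTL'' : ∀ (Y : Fin (d + 1) → ℤ) (κ : Fin (d + 1)) (u : Fin (d + 1) → ℤ),
      cH' • ∑ v ∈ box (d + 1) Lc, divV (T2RecAt d Lc (toSite r) cE cVH cΛ cE₂ cB Tc vh₂S (mixFFAt (toSite r) Lc) j κ u) ((Lc : ℤ) • Y + toSite v)
        = comp (S κ u) (X Y) - comp (X Y) (S κ u) + R'' Y κ u)
    (hC : ∀ (Y : Fin (d + 1) → ℤ) (κ : Fin (d + 1)) (u : Fin (d + 1) → ℤ),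
      trK (comp (S κ u) (X Y) - comp (X Y) (S κ u)) = sgnK (comp (S κ u) (X Y) - comp (X Y) (S κ u)))
    (hR : ∀ (Y : Fin (d + 1) → ℤ) (κ : Fin (d + 1)) (u : Fin (d + 1) → ℤ), trK (R Y κ u) = -sgnK (R Y κ u))
    (hR'' : ∀ (Y : Fin (d + 1) → ℤ) (κ : Fin (d + 1)) (u : Fin (d + 1) → ℤ), trK (R'' Y κ u) = -sgnK (R'' Y κ u))
    (ε : ℝ) (y : Fin (d + 1) → ℤ) (ν : Fin (d + 1)) (y' : Fin (d + 1) → ℤ) :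
    divW ((1 / 2 : ℝ) • (unitS₂ (sfStep Lc (j + 1)) (smStep d Lc (j + 1)) (T2RecAt d Lc (toSite r) cE cVH cΛ cE₂ cB Tc vh₂S (mixFFAt (toSite r) Lc) (j + 1))
          + ε • fun κ u κ' u' => sgnK (trK (unitS₂ (sfStep Lc (j + 1)) (smStep d Lc (j + 1)) (T2RecAt d Lc (toSite r) cE cVH cΛ cE₂ cB Tc vh₂S (mixFFAt (toSite r) Lc) (j + 1)) κ u κ' u')))) y ν y'
      = divW ((1 / 2 : ℝ) • ((fun κ u κ' u' => (cE₂ * (Lc : ℝ) ^ (2 * (d + 1))) • mmRead Lc (K3OfK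
            (unitK (sfStep Lc j) (smStep d Lc j) (coDressKBmAt (toSite r) Lc (KInvStep (d := d) Lc j))) Lc
            (unitS (sfStep Lc j) (smStep d Lc j) (SpureRecAt d Lc (toSite r) cE cVH cΛ j)) (unitM (sfStep Lc j) (smStep d Lc j) (M1At d Lc (toSite r) cΛ j))
            (W2SymOfK (unitK (sfStep Lc j) (smStep d Lc j) (coDressKBmAt (toSite r) Lc (KInvStep (d := d) Lc j))) Lc
              (unitS (sfStep Lc j) (smStep d Lc j) (SpureRecAt d Lc (toSite r) cE cVH cΛ j)) (unitM (sfStep Lc j) (smStep d Lc j) (M1At d Lc (toSite r) cΛ j)) 0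
              (unitM₂ (sfStep Lc j) (smStep d Lc j) (M2Of d Lc (mixFFAt (toSite r) Lc) j))) κ u κ' u') + cB • vh₂S κ u κ' u')
          + ε • fun κ u κ' u' => sgnK (trK ((fun κ u κ' u' => (cE₂ * (Lc : ℝ) ^ (2 * (d + 1))) • mmRead Lc (K3OfK
            (unitK (sfStep Lc j) (smStep d Lc j) (coDressKBmAt (toSite r) Lc (KInvStep (d := d) Lc j))) Lc
            (unitS (sfStep Lc j) (smStep d Lc j) (SpureRecAt d Lc (toSite r) cE cVH cΛ j)) (unitM (sfStep Lc j) (smStep d Lc j) (M1At d Lc (toSite r) cΛ j))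
            (W2SymOfK (unitK (sfStep Lc j) (smStep d Lc j) (coDressKBmAt (toSite r) Lc (KInvStep (d := d) Lc j))) Lc
              (unitS (sfStep Lc j) (smStep d Lc j) (SpureRecAt d Lc (toSite r) cE cVH cΛ j)) (unitM (sfStep Lc j) (smStep d Lc j) (M1At d Lc (toSite r) cΛ j)) 0
              (unitM₂ (sfStep Lc j) (smStep d Lc j) (M2Of d Lc (mixFFAt (toSite r) Lc) j))) κ u κ' u') + cB • vh₂S κ u κ' u') κ u κ' u')))) y ν y'
        + (cE₂ * (Lc : ℝ) ^ (2 * (d + 1)) * ((Lc : ℝ) ^ (d + 1))⁻¹ / 2) •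
          (e3OfK Lc (unitK (sfStep Lc j) (smStep d Lc j) (coDressKBmAt (toSite r) Lc (KInvStep (d := d) Lc j)))
              (fun κ' u' => (sfStep Lc j * smStep d Lc j)⁻¹ • unitS (sfStep Lc j) (smStep d Lc j)
                (fun κ' u' => cH'⁻¹ • ((((1 : ℝ) + ε) / 2) • (comp (S κ' u') (X y) - comp (X y) (S κ' u')) + (((1 : ℝ) - ε) / 2) • R y κ' u')) κ' u') ν y'
            + e3OfK Lc (unitK (sfStep Lc j) (smStep d Lc j) (coDressKBmAt (toSite r) Lc (KInvStep (d := d) Lc j)))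
              (fun κ u => (sfStep Lc j * smStep d Lc j)⁻¹ • unitS (sfStep Lc j) (smStep d Lc j)
                (fun κ u => cH'⁻¹ • ((((1 : ℝ) + ε) / 2) • (comp (S κ u) (X y) - comp (X y) (S κ u)) + (((1 : ℝ) - ε) / 2) • R'' y κ u)) κ u) ν y') := by
  have e₁ : (fun κ' u' => ∑ v ∈ box (d + 1) Lc, divV (fun κ u =>
        ((1 / 2 : ℝ) • (unitS₂ (sfStep Lc j) (smStep d Lc j) (T2RecAt d Lc (toSite r) cE cVH cΛ cE₂ cB Tc vh₂S (mixFFAt (toSite r) Lc) j)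
          + ε • fun κ u κ' u' => sgnK (trK (unitS₂ (sfStep Lc j) (smStep d Lc j) (T2RecAt d Lc (toSite r) cE cVH cΛ cE₂ cB Tc vh₂S (mixFFAt (toSite r) Lc) j) κ u κ' u')))) κ u κ' u')
        ((Lc : ℤ) • y + toSite v))
      = fun κ' u' => (sfStep Lc j * smStep d Lc j)⁻¹ • unitS (sfStep Lc j) (smStep d Lc j)
          (fun κ' u' => cH'⁻¹ • ((((1 : ℝ) + ε) / 2) • (comp (S κ' u') (X y) - comp (X y) (S κ' u')) + (((1 : ℝ) - ε) / 2) • R y κ' u')) κ' u' :=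
    funext fun κ' => funext fun u' => boxSum_divV_half_fst_of_tableLaw (sfStep Lc j) (smStep d Lc j) hcH hTL hC hR ε y κ' u'
  have e₂ : (fun κ u => ∑ v ∈ box (d + 1) Lc, divV
        (((1 / 2 : ℝ) • (unitS₂ (sfStep Lc j) (smStep d Lc j) (T2RecAt d Lc (toSite r) cE cVH cΛ cE₂ cB Tc vh₂S (mixFFAt (toSite r) Lc) j)
          + ε • fun κ u κ' u' => sgnK (trK (unitS₂ (sfStep Lc j) (smStep d Lc j) (T2RecAt d Lc (toSite r) cE cVH cΛ cE₂ cB Tc vh₂S (mixFFAt (toSite r) Lc) j) κ u κ' u')))) κ u)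
        ((Lc : ℤ) • y + toSite v))
      = fun κ u => (sfStep Lc j * smStep d Lc j)⁻¹ • unitS (sfStep Lc j) (smStep d Lc j)
          (fun κ u => cH'⁻¹ • ((((1 : ℝ) + ε) / 2) • (comp (S κ u) (X y) - comp (X y) (S κ u)) + (((1 : ℝ) - ε) / 2) • R'' y κ u)) κ u :=
    funext fun κ => funext fun u => boxSum_divV_half_snd_of_tableLaw (sfStep Lc j) (smStep d Lc j) hcH hTL'' hC hR'' ε y κ u
  rw [divW_halfMember_succ_eq hLc hr cE cVH cΛ cE₂ cB Tc hBff hBmm hB ε j y ν y', e₁, e₂]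

/-! ### §3b The SECOND slot: `lin4` is slot-symmetric, so the same two `e3OfK` summands appear -/

/-- NOT IN PRINT; OUR BOOKKEEPING.  **T-EQ ON THE `ε`-MEMBER, SECOND SLOT** (hypothesis-free; every `ε j p κ u`): `divV (y_{j+1} κ u) p = divV ((½ • (b♮̃_j + ε • P b♮̃_j)) κ u) p
+ (c₄·(Lc^{d+1})⁻¹∕2) • (e3OfK Lc K♮ᴱ_j F₁^{ε}(p) κ u + e3OfK Lc K♮ᴱ_j F₂^{ε}(p) κ u)` — the SAME two summands as the first slot (PART 1 §1) read at the slot `(κ, u)`: road W3's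
one-step map is slot-symmetric (leaf-03 g58's `Lin4SlotDivergence.lin4_swap_slots`), so the second-slot divergence of `𝒜^Ĝ_j y_j` is its first-slot divergence (PART 1
`halfMember_succ_eq` ⨾ swap ⨾ `divW_lin4_comb`). -/
theorem divV_snd_halfMember_succ_eq (hLc : 1 ≤ Lc) (hr : r ∈ box (d + 1) Lc) (cE cVH cΛ cE₂ cB : ℝ) (Tc : Fin 4 → Fin 4 → Fin 4 → Fin 4 → ℝ)
    {vh₂S : Tab d} (hBff : ∀ κ u κ' u' x z (α β : Fin (d + 1)), vh₂S κ u κ' u' x z (Sum.inl α) (Sum.inl β) = 0)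
    (hBmm : ∀ κ u κ' u' x z (μ ν : Fin (d + 1)), vh₂S κ u κ' u' x z (Sum.inr μ) (Sum.inr ν) = 0)
    (hB : ∃ C δ : ℝ, 0 < δ ∧ LocStencil₂ vh₂S C δ) (ε : ℝ) (j : ℕ)
    (p : Fin (d + 1) → ℤ) (κ : Fin (d + 1)) (u : Fin (d + 1) → ℤ) :
    divV (((1 / 2 : ℝ) • (unitS₂ (sfStep Lc (j + 1)) (smStep d Lc (j + 1)) (T2RecAt d Lc (toSite r) cE cVH cΛ cE₂ cB Tc vh₂S (mixFFAt (toSite r) Lc) (j + 1))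
          + ε • fun κ u κ' u' => sgnK (trK (unitS₂ (sfStep Lc (j + 1)) (smStep d Lc (j + 1)) (T2RecAt d Lc (toSite r) cE cVH cΛ cE₂ cB Tc vh₂S (mixFFAt (toSite r) Lc) (j + 1)) κ u κ' u')))) κ u) p
      = divV (((1 / 2 : ℝ) • ((fun κ u κ' u' => (cE₂ * (Lc : ℝ) ^ (2 * (d + 1))) • mmRead Lc (K3OfK
            (unitK (sfStep Lc j) (smStep d Lc j) (coDressKBmAt (toSite r) Lc (KInvStep (d := d) Lc j))) Lc
            (unitS (sfStep Lc j) (smStep d Lc j) (SpureRecAt d Lc (toSite r) cE cVH cΛ j)) (unitM (sfStep Lc j) (smStep d Lc j) (M1At d Lc (toSite r) cΛ j))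
            (W2SymOfK (unitK (sfStep Lc j) (smStep d Lc j) (coDressKBmAt (toSite r) Lc (KInvStep (d := d) Lc j))) Lc
              (unitS (sfStep Lc j) (smStep d Lc j) (SpureRecAt d Lc (toSite r) cE cVH cΛ j)) (unitM (sfStep Lc j) (smStep d Lc j) (M1At d Lc (toSite r) cΛ j)) 0
              (unitM₂ (sfStep Lc j) (smStep d Lc j) (M2Of d Lc (mixFFAt (toSite r) Lc) j))) κ u κ' u') + cB • vh₂S κ u κ' u')
          + ε • fun κ u κ' u' => sgnK (trK ((fun κ u κ' u' => (cE₂ * (Lc : ℝ) ^ (2 * (d + 1))) • mmRead Lc (K3OfK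
            (unitK (sfStep Lc j) (smStep d Lc j) (coDressKBmAt (toSite r) Lc (KInvStep (d := d) Lc j))) Lc
            (unitS (sfStep Lc j) (smStep d Lc j) (SpureRecAt d Lc (toSite r) cE cVH cΛ j)) (unitM (sfStep Lc j) (smStep d Lc j) (M1At d Lc (toSite r) cΛ j))
            (W2SymOfK (unitK (sfStep Lc j) (smStep d Lc j) (coDressKBmAt (toSite r) Lc (KInvStep (d := d) Lc j))) Lc
              (unitS (sfStep Lc j) (smStep d Lc j) (SpureRecAt d Lc (toSite r) cE cVH cΛ j)) (unitM (sfStep Lc j) (smStep d Lc j) (M1At d Lc (toSite r) cΛ j)) 0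
              (unitM₂ (sfStep Lc j) (smStep d Lc j) (M2Of d Lc (mixFFAt (toSite r) Lc) j))) κ u κ' u') + cB • vh₂S κ u κ' u') κ u κ' u')))) κ u) p
        + (cE₂ * (Lc : ℝ) ^ (2 * (d + 1)) * ((Lc : ℝ) ^ (d + 1))⁻¹ / 2) •
          (e3OfK Lc (unitK (sfStep Lc j) (smStep d Lc j) (coDressKBmAt (toSite r) Lc (KInvStep (d := d) Lc j)))
              (fun κ' u' => ∑ v ∈ box (d + 1) Lc, divV (fun κ₁ u₁ =>
                ((1 / 2 : ℝ) • (unitS₂ (sfStep Lc j) (smStep d Lc j) (T2RecAt d Lc (toSite r) cE cVH cΛ cE₂ cB Tc vh₂S (mixFFAt (toSite r) Lc) j)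
          + ε • fun κ u κ' u' => sgnK (trK (unitS₂ (sfStep Lc j) (smStep d Lc j) (T2RecAt d Lc (toSite r) cE cVH cΛ cE₂ cB Tc vh₂S (mixFFAt (toSite r) Lc) j) κ u κ' u')))) κ₁ u₁ κ' u')
                ((Lc : ℤ) • p + toSite v)) κ u
            + e3OfK Lc (unitK (sfStep Lc j) (smStep d Lc j) (coDressKBmAt (toSite r) Lc (KInvStep (d := d) Lc j)))
              (fun κ₁ u₁ => ∑ v ∈ box (d + 1) Lc, divV
                (((1 / 2 : ℝ) • (unitS₂ (sfStep Lc j) (smStep d Lc j) (T2RecAt d Lc (toSite r) cE cVH cΛ cE₂ cB Tc vh₂S (mixFFAt (toSite r) Lc) j)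
          + ε • fun κ u κ' u' => sgnK (trK (unitS₂ (sfStep Lc j) (smStep d Lc j) (T2RecAt d Lc (toSite r) cE cVH cΛ cE₂ cB Tc vh₂S (mixFFAt (toSite r) Lc) j) κ u κ' u')))) κ₁ u₁)
                ((Lc : ℤ) • p + toSite v)) κ u) := by
  obtain ⟨B, hBy⟩ := bdd₄_halfMember hLc hr cE cVH cΛ cE₂ cB Tc hB ε j
  -- the second-slot divergence is the first-slot divergence of the slot-swapped table
  have e : divV (((1 / 2 : ℝ) • (unitS₂ (sfStep Lc (j + 1)) (smStep d Lc (j + 1)) (T2RecAt d Lc (toSite r) cE cVH cΛ cE₂ cB Tc vh₂S (mixFFAt (toSite r) Lc) (j + 1))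
          + ε • fun κ u κ' u' => sgnK (trK (unitS₂ (sfStep Lc (j + 1)) (smStep d Lc (j + 1)) (T2RecAt d Lc (toSite r) cE cVH cΛ cE₂ cB Tc vh₂S (mixFFAt (toSite r) Lc) (j + 1)) κ u κ' u')))) κ u) p
      = divW (fun μ q κ' u' => ((1 / 2 : ℝ) • (unitS₂ (sfStep Lc (j + 1)) (smStep d Lc (j + 1)) (T2RecAt d Lc (toSite r) cE cVH cΛ cE₂ cB Tc vh₂S (mixFFAt (toSite r) Lc) (j + 1))
          + ε • fun κ u κ' u' => sgnK (trK (unitS₂ (sfStep Lc (j + 1)) (smStep d Lc (j + 1)) (T2RecAt d Lc (toSite r) cE cVH cΛ cE₂ cB Tc vh₂S (mixFFAt (toSite r) Lc) (j + 1)) κ u κ' u')))) κ' u' μ q) p κ u := rfl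
  rw [e, halfMember_succ_eq hLc hr cE cVH cΛ cE₂ cB Tc hBff hBmm hB ε j]
  have e2 : (fun μ q κ' u' => (lin4 (cE₂ * (Lc : ℝ) ^ (2 * (d + 1))) (unitK (sfStep Lc j) (smStep d Lc j) (coDressKBmAt (toSite r) Lc (KInvStep (d := d) Lc j))) Lc
          ((1 / 2 : ℝ) • (unitS₂ (sfStep Lc j) (smStep d Lc j) (T2RecAt d Lc (toSite r) cE cVH cΛ cE₂ cB Tc vh₂S (mixFFAt (toSite r) Lc) j)
          + ε • fun κ u κ' u' => sgnK (trK (unitS₂ (sfStep Lc j) (smStep d Lc j) (T2RecAt d Lc (toSite r) cE cVH cΛ cE₂ cB Tc vh₂S (mixFFAt (toSite r) Lc) j) κ u κ' u'))))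
        + ((1 / 2 : ℝ) • ((fun κ u κ' u' => (cE₂ * (Lc : ℝ) ^ (2 * (d + 1))) • mmRead Lc (K3OfK
            (unitK (sfStep Lc j) (smStep d Lc j) (coDressKBmAt (toSite r) Lc (KInvStep (d := d) Lc j))) Lc
            (unitS (sfStep Lc j) (smStep d Lc j) (SpureRecAt d Lc (toSite r) cE cVH cΛ j)) (unitM (sfStep Lc j) (smStep d Lc j) (M1At d Lc (toSite r) cΛ j))
            (W2SymOfK (unitK (sfStep Lc j) (smStep d Lc j) (coDressKBmAt (toSite r) Lc (KInvStep (d := d) Lc j))) Lc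
              (unitS (sfStep Lc j) (smStep d Lc j) (SpureRecAt d Lc (toSite r) cE cVH cΛ j)) (unitM (sfStep Lc j) (smStep d Lc j) (M1At d Lc (toSite r) cΛ j)) 0
              (unitM₂ (sfStep Lc j) (smStep d Lc j) (M2Of d Lc (mixFFAt (toSite r) Lc) j))) κ u κ' u') + cB • vh₂S κ u κ' u')
          + ε • fun κ u κ' u' => sgnK (trK ((fun κ u κ' u' => (cE₂ * (Lc : ℝ) ^ (2 * (d + 1))) • mmRead Lc (K3OfK
            (unitK (sfStep Lc j) (smStep d Lc j) (coDressKBmAt (toSite r) Lc (KInvStep (d := d) Lc j))) Lc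
            (unitS (sfStep Lc j) (smStep d Lc j) (SpureRecAt d Lc (toSite r) cE cVH cΛ j)) (unitM (sfStep Lc j) (smStep d Lc j) (M1At d Lc (toSite r) cΛ j))
            (W2SymOfK (unitK (sfStep Lc j) (smStep d Lc j) (coDressKBmAt (toSite r) Lc (KInvStep (d := d) Lc j))) Lc
              (unitS (sfStep Lc j) (smStep d Lc j) (SpureRecAt d Lc (toSite r) cE cVH cΛ j)) (unitM (sfStep Lc j) (smStep d Lc j) (M1At d Lc (toSite r) cΛ j)) 0
              (unitM₂ (sfStep Lc j) (smStep d Lc j) (M2Of d Lc (mixFFAt (toSite r) Lc) j))) κ u κ' u') + cB • vh₂S κ u κ' u') κ u κ' u'))))) κ' u' μ q)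
      = lin4 (cE₂ * (Lc : ℝ) ^ (2 * (d + 1))) (unitK (sfStep Lc j) (smStep d Lc j) (coDressKBmAt (toSite r) Lc (KInvStep (d := d) Lc j))) Lc
          ((1 / 2 : ℝ) • (unitS₂ (sfStep Lc j) (smStep d Lc j) (T2RecAt d Lc (toSite r) cE cVH cΛ cE₂ cB Tc vh₂S (mixFFAt (toSite r) Lc) j)
          + ε • fun κ u κ' u' => sgnK (trK (unitS₂ (sfStep Lc j) (smStep d Lc j) (T2RecAt d Lc (toSite r) cE cVH cΛ cE₂ cB Tc vh₂S (mixFFAt (toSite r) Lc) j) κ u κ' u'))))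
        + fun μ q κ' u' => ((1 / 2 : ℝ) • ((fun κ u κ' u' => (cE₂ * (Lc : ℝ) ^ (2 * (d + 1))) • mmRead Lc (K3OfK
            (unitK (sfStep Lc j) (smStep d Lc j) (coDressKBmAt (toSite r) Lc (KInvStep (d := d) Lc j))) Lc
            (unitS (sfStep Lc j) (smStep d Lc j) (SpureRecAt d Lc (toSite r) cE cVH cΛ j)) (unitM (sfStep Lc j) (smStep d Lc j) (M1At d Lc (toSite r) cΛ j))
            (W2SymOfK (unitK (sfStep Lc j) (smStep d Lc j) (coDressKBmAt (toSite r) Lc (KInvStep (d := d) Lc j))) Lc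
              (unitS (sfStep Lc j) (smStep d Lc j) (SpureRecAt d Lc (toSite r) cE cVH cΛ j)) (unitM (sfStep Lc j) (smStep d Lc j) (M1At d Lc (toSite r) cΛ j)) 0
              (unitM₂ (sfStep Lc j) (smStep d Lc j) (M2Of d Lc (mixFFAt (toSite r) Lc) j))) κ u κ' u') + cB • vh₂S κ u κ' u')
          + ε • fun κ u κ' u' => sgnK (trK ((fun κ u κ' u' => (cE₂ * (Lc : ℝ) ^ (2 * (d + 1))) • mmRead Lc (K3OfK
            (unitK (sfStep Lc j) (smStep d Lc j) (coDressKBmAt (toSite r) Lc (KInvStep (d := d) Lc j))) Lc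
            (unitS (sfStep Lc j) (smStep d Lc j) (SpureRecAt d Lc (toSite r) cE cVH cΛ j)) (unitM (sfStep Lc j) (smStep d Lc j) (M1At d Lc (toSite r) cΛ j))
            (W2SymOfK (unitK (sfStep Lc j) (smStep d Lc j) (coDressKBmAt (toSite r) Lc (KInvStep (d := d) Lc j))) Lc
              (unitS (sfStep Lc j) (smStep d Lc j) (SpureRecAt d Lc (toSite r) cE cVH cΛ j)) (unitM (sfStep Lc j) (smStep d Lc j) (M1At d Lc (toSite r) cΛ j)) 0
              (unitM₂ (sfStep Lc j) (smStep d Lc j) (M2Of d Lc (mixFFAt (toSite r) Lc) j))) κ u κ' u') + cB • vh₂S κ u κ' u') κ u κ' u')))) κ' u' μ q := by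
    funext μ q κ' u'
    simp only [Pi.add_apply]
    rw [lin4_swap_slots]
  rw [e2, divW_add_apply, divW_lin4_comb hr j _ hBy p κ u]
  exact add_comm _ _

/-- NOT IN PRINT; OUR BOOKKEEPING.  **SLAVE-src FOR THE `ε`-MEMBER, SECOND SLOT** (letters `S X R R″ cH′` + parities `hC hR hR″` as in §3): `divV (y_{j+1} κ u) p =
divV ((½ • (b♮̃_j + ε • P b♮̃_j)) κ u) p + (c₄·Lc^{−(d+1)}∕2) • (e3OfK Lc K♮ᴱ_j [(sf_j·sm_j)⁻¹ • unitS_j (cH′⁻¹ • (((1+ε)∕2) • (S ∘ X_p − X_p ∘ S) + ((1−ε)∕2) • R p))] κ u +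
the ″ twin)` (§3b T-EQ + PART 1 §2). -/
theorem divV_snd_halfMember_succ_eq_slaved (hLc : 1 ≤ Lc) (hr : r ∈ box (d + 1) Lc) (cE cVH cΛ cE₂ cB : ℝ) (Tc : Fin 4 → Fin 4 → Fin 4 → Fin 4 → ℝ)
    {vh₂S : Tab d} (hBff : ∀ κ u κ' u' x z (α β : Fin (d + 1)), vh₂S κ u κ' u' x z (Sum.inl α) (Sum.inl β) = 0)
    (hBmm : ∀ κ u κ' u' x z (μ ν : Fin (d + 1)), vh₂S κ u κ' u' x z (Sum.inr μ) (Sum.inr ν) = 0)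
    (hB : ∃ C δ : ℝ, 0 < δ ∧ LocStencil₂ vh₂S C δ) (j : ℕ)
    {S : Fin (d + 1) → (Fin (d + 1) → ℤ) → MKer (d + 1) (Fib d)} {X : (Fin (d + 1) → ℤ) → MKer (d + 1) (Fib d)}
    {R R'' : (Fin (d + 1) → ℤ) → Fin (d + 1) → (Fin (d + 1) → ℤ) → MKer (d + 1) (Fib d)} {cH' : ℝ} (hcH : cH' ≠ 0)
    (hTL : ∀ (Y : Fin (d + 1) → ℤ) (κ' : Fin (d + 1)) (u' : Fin (d + 1) → ℤ),
      cH' • ∑ v ∈ box (d + 1) Lc, divV (fun κ u => T2RecAt d Lc (toSite r) cE cVH cΛ cE₂ cB Tc vh₂S (mixFFAt (toSite r) Lc) j κ u κ' u') ((Lc : ℤ) • Y + toSite v)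
        = comp (S κ' u') (X Y) - comp (X Y) (S κ' u') + R Y κ' u')
    (hTL'' : ∀ (Y : Fin (d + 1) → ℤ) (κ : Fin (d + 1)) (u : Fin (d + 1) → ℤ),
      cH' • ∑ v ∈ box (d + 1) Lc, divV (T2RecAt d Lc (toSite r) cE cVH cΛ cE₂ cB Tc vh₂S (mixFFAt (toSite r) Lc) j κ u) ((Lc : ℤ) • Y + toSite v)
        = comp (S κ u) (X Y) - comp (X Y) (S κ u) + R'' Y κ u)
    (hC : ∀ (Y : Fin (d + 1) → ℤ) (κ : Fin (d + 1)) (u : Fin (d + 1) → ℤ),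
      trK (comp (S κ u) (X Y) - comp (X Y) (S κ u)) = sgnK (comp (S κ u) (X Y) - comp (X Y) (S κ u)))
    (hR : ∀ (Y : Fin (d + 1) → ℤ) (κ : Fin (d + 1)) (u : Fin (d + 1) → ℤ), trK (R Y κ u) = -sgnK (R Y κ u))
    (hR'' : ∀ (Y : Fin (d + 1) → ℤ) (κ : Fin (d + 1)) (u : Fin (d + 1) → ℤ), trK (R'' Y κ u) = -sgnK (R'' Y κ u))
    (ε : ℝ) (p : Fin (d + 1) → ℤ) (κ : Fin (d + 1)) (u : Fin (d + 1) → ℤ) :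
    divV (((1 / 2 : ℝ) • (unitS₂ (sfStep Lc (j + 1)) (smStep d Lc (j + 1)) (T2RecAt d Lc (toSite r) cE cVH cΛ cE₂ cB Tc vh₂S (mixFFAt (toSite r) Lc) (j + 1))
          + ε • fun κ u κ' u' => sgnK (trK (unitS₂ (sfStep Lc (j + 1)) (smStep d Lc (j + 1)) (T2RecAt d Lc (toSite r) cE cVH cΛ cE₂ cB Tc vh₂S (mixFFAt (toSite r) Lc) (j + 1)) κ u κ' u')))) κ u) p
      = divV (((1 / 2 : ℝ) • ((fun κ u κ' u' => (cE₂ * (Lc : ℝ) ^ (2 * (d + 1))) • mmRead Lc (K3OfK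
            (unitK (sfStep Lc j) (smStep d Lc j) (coDressKBmAt (toSite r) Lc (KInvStep (d := d) Lc j))) Lc
            (unitS (sfStep Lc j) (smStep d Lc j) (SpureRecAt d Lc (toSite r) cE cVH cΛ j)) (unitM (sfStep Lc j) (smStep d Lc j) (M1At d Lc (toSite r) cΛ j))
            (W2SymOfK (unitK (sfStep Lc j) (smStep d Lc j) (coDressKBmAt (toSite r) Lc (KInvStep (d := d) Lc j))) Lc
              (unitS (sfStep Lc j) (smStep d Lc j) (SpureRecAt d Lc (toSite r) cE cVH cΛ j)) (unitM (sfStep Lc j) (smStep d Lc j) (M1At d Lc (toSite r) cΛ j)) 0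
              (unitM₂ (sfStep Lc j) (smStep d Lc j) (M2Of d Lc (mixFFAt (toSite r) Lc) j))) κ u κ' u') + cB • vh₂S κ u κ' u')
          + ε • fun κ u κ' u' => sgnK (trK ((fun κ u κ' u' => (cE₂ * (Lc : ℝ) ^ (2 * (d + 1))) • mmRead Lc (K3OfK
            (unitK (sfStep Lc j) (smStep d Lc j) (coDressKBmAt (toSite r) Lc (KInvStep (d := d) Lc j))) Lc
            (unitS (sfStep Lc j) (smStep d Lc j) (SpureRecAt d Lc (toSite r) cE cVH cΛ j)) (unitM (sfStep Lc j) (smStep d Lc j) (M1At d Lc (toSite r) cΛ j))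
            (W2SymOfK (unitK (sfStep Lc j) (smStep d Lc j) (coDressKBmAt (toSite r) Lc (KInvStep (d := d) Lc j))) Lc
              (unitS (sfStep Lc j) (smStep d Lc j) (SpureRecAt d Lc (toSite r) cE cVH cΛ j)) (unitM (sfStep Lc j) (smStep d Lc j) (M1At d Lc (toSite r) cΛ j)) 0
              (unitM₂ (sfStep Lc j) (smStep d Lc j) (M2Of d Lc (mixFFAt (toSite r) Lc) j))) κ u κ' u') + cB • vh₂S κ u κ' u') κ u κ' u')))) κ u) p
        + (cE₂ * (Lc : ℝ) ^ (2 * (d + 1)) * ((Lc : ℝ) ^ (d + 1))⁻¹ / 2) •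
          (e3OfK Lc (unitK (sfStep Lc j) (smStep d Lc j) (coDressKBmAt (toSite r) Lc (KInvStep (d := d) Lc j)))
              (fun κ' u' => (sfStep Lc j * smStep d Lc j)⁻¹ • unitS (sfStep Lc j) (smStep d Lc j)
                (fun κ' u' => cH'⁻¹ • ((((1 : ℝ) + ε) / 2) • (comp (S κ' u') (X p) - comp (X p) (S κ' u')) + (((1 : ℝ) - ε) / 2) • R p κ' u')) κ' u') κ u
            + e3OfK Lc (unitK (sfStep Lc j) (smStep d Lc j) (coDressKBmAt (toSite r) Lc (KInvStep (d := d) Lc j)))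
              (fun κ u => (sfStep Lc j * smStep d Lc j)⁻¹ • unitS (sfStep Lc j) (smStep d Lc j)
                (fun κ u => cH'⁻¹ • ((((1 : ℝ) + ε) / 2) • (comp (S κ u) (X p) - comp (X p) (S κ u)) + (((1 : ℝ) - ε) / 2) • R'' p κ u)) κ u) κ u) := by
  have e₁ : (fun κ' u' => ∑ v ∈ box (d + 1) Lc, divV (fun κ₁ u₁ =>
        ((1 / 2 : ℝ) • (unitS₂ (sfStep Lc j) (smStep d Lc j) (T2RecAt d Lc (toSite r) cE cVH cΛ cE₂ cB Tc vh₂S (mixFFAt (toSite r) Lc) j)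
          + ε • fun κ u κ' u' => sgnK (trK (unitS₂ (sfStep Lc j) (smStep d Lc j) (T2RecAt d Lc (toSite r) cE cVH cΛ cE₂ cB Tc vh₂S (mixFFAt (toSite r) Lc) j) κ u κ' u')))) κ₁ u₁ κ' u')
        ((Lc : ℤ) • p + toSite v))
      = fun κ' u' => (sfStep Lc j * smStep d Lc j)⁻¹ • unitS (sfStep Lc j) (smStep d Lc j)
          (fun κ' u' => cH'⁻¹ • ((((1 : ℝ) + ε) / 2) • (comp (S κ' u') (X p) - comp (X p) (S κ' u')) + (((1 : ℝ) - ε) / 2) • R p κ' u')) κ' u' :=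
    funext fun κ' => funext fun u' => boxSum_divV_half_fst_of_tableLaw (sfStep Lc j) (smStep d Lc j) hcH hTL hC hR ε p κ' u'
  have e₂ : (fun κ₁ u₁ => ∑ v ∈ box (d + 1) Lc, divV
        (((1 / 2 : ℝ) • (unitS₂ (sfStep Lc j) (smStep d Lc j) (T2RecAt d Lc (toSite r) cE cVH cΛ cE₂ cB Tc vh₂S (mixFFAt (toSite r) Lc) j)
          + ε • fun κ u κ' u' => sgnK (trK (unitS₂ (sfStep Lc j) (smStep d Lc j) (T2RecAt d Lc (toSite r) cE cVH cΛ cE₂ cB Tc vh₂S (mixFFAt (toSite r) Lc) j) κ u κ' u')))) κ₁ u₁)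
        ((Lc : ℤ) • p + toSite v))
      = fun κ u => (sfStep Lc j * smStep d Lc j)⁻¹ • unitS (sfStep Lc j) (smStep d Lc j)
          (fun κ u => cH'⁻¹ • ((((1 : ℝ) + ε) / 2) • (comp (S κ u) (X p) - comp (X p) (S κ u)) + (((1 : ℝ) - ε) / 2) • R'' p κ u)) κ u :=
    funext fun κ => funext fun u => boxSum_divV_half_snd_of_tableLaw (sfStep Lc j) (smStep d Lc j) hcH hTL'' hC hR'' ε p κ u
  rw [divV_snd_halfMember_succ_eq hLc hr cE cVH cΛ cE₂ cB Tc hBff hBmm hB ε j p κ u, e₁, e₂]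

/-- NOT IN PRINT; OUR BOOKKEEPING.  **(α-END-b1) «THE EVEN MEMBER's SLAVED DIVERGENCE»** (the OWNER gan24-p1 g33's displayed sentence, W9 l.49725): for the EVEN member
`T♮̃^{ev}_j := ½ • (T♮̃_j + P T♮̃_j)` (the junction's spelling) under the two raw table laws and the parities `hC hR hR″`,
`divW (T♮̃^{ev}_{j+1}) y ν y′ = divW (b♮̃^{ev}_j) y ν y′ + (c₄·(Lc^{d+1})⁻¹∕2) • (e3OfK Lc K♮ᴱ_j [(sf_j·sm_j)⁻¹ • unitS_j (κ′u′ ↦ cH′⁻¹ • (S κ′u′ ∘ X_y − X_y ∘ S κ′u′))] ν y′ + the ″ twin)`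
— **NO `R`**: the commutator is EVEN, `R` is ODD (§3 at `ε = 1`). -/
theorem divW_evenMember_succ_eq_slaved (hLc : 1 ≤ Lc) (hr : r ∈ box (d + 1) Lc) (cE cVH cΛ cE₂ cB : ℝ) (Tc : Fin 4 → Fin 4 → Fin 4 → Fin 4 → ℝ)
    {vh₂S : Tab d} (hBff : ∀ κ u κ' u' x z (α β : Fin (d + 1)), vh₂S κ u κ' u' x z (Sum.inl α) (Sum.inl β) = 0)
    (hBmm : ∀ κ u κ' u' x z (μ ν : Fin (d + 1)), vh₂S κ u κ' u' x z (Sum.inr μ) (Sum.inr ν) = 0)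
    (hB : ∃ C δ : ℝ, 0 < δ ∧ LocStencil₂ vh₂S C δ) (j : ℕ)
    {S : Fin (d + 1) → (Fin (d + 1) → ℤ) → MKer (d + 1) (Fib d)} {X : (Fin (d + 1) → ℤ) → MKer (d + 1) (Fib d)}
    {R R'' : (Fin (d + 1) → ℤ) → Fin (d + 1) → (Fin (d + 1) → ℤ) → MKer (d + 1) (Fib d)} {cH' : ℝ} (hcH : cH' ≠ 0)
    (hTL : ∀ (Y : Fin (d + 1) → ℤ) (κ' : Fin (d + 1)) (u' : Fin (d + 1) → ℤ),
      cH' • ∑ v ∈ box (d + 1) Lc, divV (fun κ u => T2RecAt d Lc (toSite r) cE cVH cΛ cE₂ cB Tc vh₂S (mixFFAt (toSite r) Lc) j κ u κ' u') ((Lc : ℤ) • Y + toSite v)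
        = comp (S κ' u') (X Y) - comp (X Y) (S κ' u') + R Y κ' u')
    (hTL'' : ∀ (Y : Fin (d + 1) → ℤ) (κ : Fin (d + 1)) (u : Fin (d + 1) → ℤ),
      cH' • ∑ v ∈ box (d + 1) Lc, divV (T2RecAt d Lc (toSite r) cE cVH cΛ cE₂ cB Tc vh₂S (mixFFAt (toSite r) Lc) j κ u) ((Lc : ℤ) • Y + toSite v)
        = comp (S κ u) (X Y) - comp (X Y) (S κ u) + R'' Y κ u)
    (hC : ∀ (Y : Fin (d + 1) → ℤ) (κ : Fin (d + 1)) (u : Fin (d + 1) → ℤ),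
      trK (comp (S κ u) (X Y) - comp (X Y) (S κ u)) = sgnK (comp (S κ u) (X Y) - comp (X Y) (S κ u)))
    (hR : ∀ (Y : Fin (d + 1) → ℤ) (κ : Fin (d + 1)) (u : Fin (d + 1) → ℤ), trK (R Y κ u) = -sgnK (R Y κ u))
    (hR'' : ∀ (Y : Fin (d + 1) → ℤ) (κ : Fin (d + 1)) (u : Fin (d + 1) → ℤ), trK (R'' Y κ u) = -sgnK (R'' Y κ u))
    (y : Fin (d + 1) → ℤ) (ν : Fin (d + 1)) (y' : Fin (d + 1) → ℤ) :
    divW ((1 / 2 : ℝ) • (unitS₂ (sfStep Lc (j + 1)) (smStep d Lc (j + 1)) (T2RecAt d Lc (toSite r) cE cVH cΛ cE₂ cB Tc vh₂S (mixFFAt (toSite r) Lc) (j + 1))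
          + fun κ u κ' u' => sgnK (trK (unitS₂ (sfStep Lc (j + 1)) (smStep d Lc (j + 1)) (T2RecAt d Lc (toSite r) cE cVH cΛ cE₂ cB Tc vh₂S (mixFFAt (toSite r) Lc) (j + 1)) κ u κ' u')))) y ν y'
      = divW ((1 / 2 : ℝ) • ((fun κ u κ' u' => (cE₂ * (Lc : ℝ) ^ (2 * (d + 1))) • mmRead Lc (K3OfK
            (unitK (sfStep Lc j) (smStep d Lc j) (coDressKBmAt (toSite r) Lc (KInvStep (d := d) Lc j))) Lc
            (unitS (sfStep Lc j) (smStep d Lc j) (SpureRecAt d Lc (toSite r) cE cVH cΛ j)) (unitM (sfStep Lc j) (smStep d Lc j) (M1At d Lc (toSite r) cΛ j))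
            (W2SymOfK (unitK (sfStep Lc j) (smStep d Lc j) (coDressKBmAt (toSite r) Lc (KInvStep (d := d) Lc j))) Lc
              (unitS (sfStep Lc j) (smStep d Lc j) (SpureRecAt d Lc (toSite r) cE cVH cΛ j)) (unitM (sfStep Lc j) (smStep d Lc j) (M1At d Lc (toSite r) cΛ j)) 0
              (unitM₂ (sfStep Lc j) (smStep d Lc j) (M2Of d Lc (mixFFAt (toSite r) Lc) j))) κ u κ' u') + cB • vh₂S κ u κ' u')
          + fun κ u κ' u' => sgnK (trK ((fun κ u κ' u' => (cE₂ * (Lc : ℝ) ^ (2 * (d + 1))) • mmRead Lc (K3OfK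
            (unitK (sfStep Lc j) (smStep d Lc j) (coDressKBmAt (toSite r) Lc (KInvStep (d := d) Lc j))) Lc
            (unitS (sfStep Lc j) (smStep d Lc j) (SpureRecAt d Lc (toSite r) cE cVH cΛ j)) (unitM (sfStep Lc j) (smStep d Lc j) (M1At d Lc (toSite r) cΛ j))
            (W2SymOfK (unitK (sfStep Lc j) (smStep d Lc j) (coDressKBmAt (toSite r) Lc (KInvStep (d := d) Lc j))) Lc
              (unitS (sfStep Lc j) (smStep d Lc j) (SpureRecAt d Lc (toSite r) cE cVH cΛ j)) (unitM (sfStep Lc j) (smStep d Lc j) (M1At d Lc (toSite r) cΛ j)) 0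
              (unitM₂ (sfStep Lc j) (smStep d Lc j) (M2Of d Lc (mixFFAt (toSite r) Lc) j))) κ u κ' u') + cB • vh₂S κ u κ' u') κ u κ' u')))) y ν y'
        + (cE₂ * (Lc : ℝ) ^ (2 * (d + 1)) * ((Lc : ℝ) ^ (d + 1))⁻¹ / 2) •
          (e3OfK Lc (unitK (sfStep Lc j) (smStep d Lc j) (coDressKBmAt (toSite r) Lc (KInvStep (d := d) Lc j)))
              (fun κ' u' => (sfStep Lc j * smStep d Lc j)⁻¹ • unitS (sfStep Lc j) (smStep d Lc j)
                (fun κ' u' => cH'⁻¹ • (comp (S κ' u') (X y) - comp (X y) (S κ' u'))) κ' u') ν y'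
            + e3OfK Lc (unitK (sfStep Lc j) (smStep d Lc j) (coDressKBmAt (toSite r) Lc (KInvStep (d := d) Lc j)))
              (fun κ u => (sfStep Lc j * smStep d Lc j)⁻¹ • unitS (sfStep Lc j) (smStep d Lc j)
                (fun κ u => cH'⁻¹ • (comp (S κ u) (X y) - comp (X y) (S κ u))) κ u) ν y') := by
  have h := divW_halfMember_succ_eq_slaved hLc hr cE cVH cΛ cE₂ cB Tc hBff hBmm hB j hcH hTL hTL'' hC hR hR'' 1 y ν y'
  have h1 : ((1 : ℝ) + 1) / 2 = 1 := by norm_num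
  have h0 : ((1 : ℝ) - 1) / 2 = 0 := by norm_num
  rw [h1, h0] at h
  simp only [one_smul, zero_smul, add_zero] at h
  exact h

/-- NOT IN PRINT; OUR BOOKKEEPING.  **THE ODD MEMBER's SLAVED DIVERGENCE IS PURE RESIDUAL**: for `T♮̃^{od}_j := ½ • (T♮̃_j − P T♮̃_j)` under the same letters,
`divW (T♮̃^{od}_{j+1}) y ν y′ = divW (b♮̃^{od}_j) y ν y′ + (c₄·(Lc^{d+1})⁻¹∕2) • (e3OfK Lc K♮ᴱ_j [(sf_j·sm_j)⁻¹ • unitS_j (κ′u′ ↦ cH′⁻¹ • R y κ′u′)] ν y′ + the ″ twin with `R″`)`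
— **NO COMMUTATOR** (§3 at `ε = −1`); the half the D1 consumer is blind to (the OWNER's `WSlotParityBlind`), where (β) of record lives. -/
theorem divW_oddMember_succ_eq_slaved (hLc : 1 ≤ Lc) (hr : r ∈ box (d + 1) Lc) (cE cVH cΛ cE₂ cB : ℝ) (Tc : Fin 4 → Fin 4 → Fin 4 → Fin 4 → ℝ)
    {vh₂S : Tab d} (hBff : ∀ κ u κ' u' x z (α β : Fin (d + 1)), vh₂S κ u κ' u' x z (Sum.inl α) (Sum.inl β) = 0)
    (hBmm : ∀ κ u κ' u' x z (μ ν : Fin (d + 1)), vh₂S κ u κ' u' x z (Sum.inr μ) (Sum.inr ν) = 0)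
    (hB : ∃ C δ : ℝ, 0 < δ ∧ LocStencil₂ vh₂S C δ) (j : ℕ)
    {S : Fin (d + 1) → (Fin (d + 1) → ℤ) → MKer (d + 1) (Fib d)} {X : (Fin (d + 1) → ℤ) → MKer (d + 1) (Fib d)}
    {R R'' : (Fin (d + 1) → ℤ) → Fin (d + 1) → (Fin (d + 1) → ℤ) → MKer (d + 1) (Fib d)} {cH' : ℝ} (hcH : cH' ≠ 0)
    (hTL : ∀ (Y : Fin (d + 1) → ℤ) (κ' : Fin (d + 1)) (u' : Fin (d + 1) → ℤ),
      cH' • ∑ v ∈ box (d + 1) Lc, divV (fun κ u => T2RecAt d Lc (toSite r) cE cVH cΛ cE₂ cB Tc vh₂S (mixFFAt (toSite r) Lc) j κ u κ' u') ((Lc : ℤ) • Y + toSite v)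
        = comp (S κ' u') (X Y) - comp (X Y) (S κ' u') + R Y κ' u')
    (hTL'' : ∀ (Y : Fin (d + 1) → ℤ) (κ : Fin (d + 1)) (u : Fin (d + 1) → ℤ),
      cH' • ∑ v ∈ box (d + 1) Lc, divV (T2RecAt d Lc (toSite r) cE cVH cΛ cE₂ cB Tc vh₂S (mixFFAt (toSite r) Lc) j κ u) ((Lc : ℤ) • Y + toSite v)
        = comp (S κ u) (X Y) - comp (X Y) (S κ u) + R'' Y κ u)
    (hC : ∀ (Y : Fin (d + 1) → ℤ) (κ : Fin (d + 1)) (u : Fin (d + 1) → ℤ),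
      trK (comp (S κ u) (X Y) - comp (X Y) (S κ u)) = sgnK (comp (S κ u) (X Y) - comp (X Y) (S κ u)))
    (hR : ∀ (Y : Fin (d + 1) → ℤ) (κ : Fin (d + 1)) (u : Fin (d + 1) → ℤ), trK (R Y κ u) = -sgnK (R Y κ u))
    (hR'' : ∀ (Y : Fin (d + 1) → ℤ) (κ : Fin (d + 1)) (u : Fin (d + 1) → ℤ), trK (R'' Y κ u) = -sgnK (R'' Y κ u))
    (y : Fin (d + 1) → ℤ) (ν : Fin (d + 1)) (y' : Fin (d + 1) → ℤ) :
    divW ((1 / 2 : ℝ) • (unitS₂ (sfStep Lc (j + 1)) (smStep d Lc (j + 1)) (T2RecAt d Lc (toSite r) cE cVH cΛ cE₂ cB Tc vh₂S (mixFFAt (toSite r) Lc) (j + 1))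
          - fun κ u κ' u' => sgnK (trK (unitS₂ (sfStep Lc (j + 1)) (smStep d Lc (j + 1)) (T2RecAt d Lc (toSite r) cE cVH cΛ cE₂ cB Tc vh₂S (mixFFAt (toSite r) Lc) (j + 1)) κ u κ' u')))) y ν y'
      = divW ((1 / 2 : ℝ) • ((fun κ u κ' u' => (cE₂ * (Lc : ℝ) ^ (2 * (d + 1))) • mmRead Lc (K3OfK
            (unitK (sfStep Lc j) (smStep d Lc j) (coDressKBmAt (toSite r) Lc (KInvStep (d := d) Lc j))) Lc
            (unitS (sfStep Lc j) (smStep d Lc j) (SpureRecAt d Lc (toSite r) cE cVH cΛ j)) (unitM (sfStep Lc j) (smStep d Lc j) (M1At d Lc (toSite r) cΛ j))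
            (W2SymOfK (unitK (sfStep Lc j) (smStep d Lc j) (coDressKBmAt (toSite r) Lc (KInvStep (d := d) Lc j))) Lc
              (unitS (sfStep Lc j) (smStep d Lc j) (SpureRecAt d Lc (toSite r) cE cVH cΛ j)) (unitM (sfStep Lc j) (smStep d Lc j) (M1At d Lc (toSite r) cΛ j)) 0
              (unitM₂ (sfStep Lc j) (smStep d Lc j) (M2Of d Lc (mixFFAt (toSite r) Lc) j))) κ u κ' u') + cB • vh₂S κ u κ' u')
          - fun κ u κ' u' => sgnK (trK ((fun κ u κ' u' => (cE₂ * (Lc : ℝ) ^ (2 * (d + 1))) • mmRead Lc (K3OfK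
            (unitK (sfStep Lc j) (smStep d Lc j) (coDressKBmAt (toSite r) Lc (KInvStep (d := d) Lc j))) Lc
            (unitS (sfStep Lc j) (smStep d Lc j) (SpureRecAt d Lc (toSite r) cE cVH cΛ j)) (unitM (sfStep Lc j) (smStep d Lc j) (M1At d Lc (toSite r) cΛ j))
            (W2SymOfK (unitK (sfStep Lc j) (smStep d Lc j) (coDressKBmAt (toSite r) Lc (KInvStep (d := d) Lc j))) Lc
              (unitS (sfStep Lc j) (smStep d Lc j) (SpureRecAt d Lc (toSite r) cE cVH cΛ j)) (unitM (sfStep Lc j) (smStep d Lc j) (M1At d Lc (toSite r) cΛ j)) 0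
              (unitM₂ (sfStep Lc j) (smStep d Lc j) (M2Of d Lc (mixFFAt (toSite r) Lc) j))) κ u κ' u') + cB • vh₂S κ u κ' u') κ u κ' u')))) y ν y'
        + (cE₂ * (Lc : ℝ) ^ (2 * (d + 1)) * ((Lc : ℝ) ^ (d + 1))⁻¹ / 2) •
          (e3OfK Lc (unitK (sfStep Lc j) (smStep d Lc j) (coDressKBmAt (toSite r) Lc (KInvStep (d := d) Lc j)))
              (fun κ' u' => (sfStep Lc j * smStep d Lc j)⁻¹ • unitS (sfStep Lc j) (smStep d Lc j)
                (fun κ' u' => cH'⁻¹ • R y κ' u') κ' u') ν y'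
            + e3OfK Lc (unitK (sfStep Lc j) (smStep d Lc j) (coDressKBmAt (toSite r) Lc (KInvStep (d := d) Lc j)))
              (fun κ u => (sfStep Lc j * smStep d Lc j)⁻¹ • unitS (sfStep Lc j) (smStep d Lc j)
                (fun κ u => cH'⁻¹ • R'' y κ u) κ u) ν y') := by
  have h := divW_halfMember_succ_eq_slaved hLc hr cE cVH cΛ cE₂ cB Tc hBff hBmm hB j hcH hTL hTL'' hC hR hR'' (-1) y ν y'
  have h1 : ((1 : ℝ) + -1) / 2 = 0 := by norm_num
  have h0 : ((1 : ℝ) - -1) / 2 = 1 := by norm_num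
  rw [h1, h0] at h
  simp only [one_smul, zero_smul, zero_add, neg_one_smul] at h
  simp only [← sub_eq_add_neg] at h
  exact h

end Comb

end Summit.QuantumFields.BalabanUV.Beta.GAN24.HalfMemberSlavedDivergenceComb

end
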